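import Summits.BirchSwinnertonDyer.Rank1Residual.Additive.PotSupersingularClasses
import Summits.BirchSwinnertonDyer.Rank1Residual.O6.X3KatoMemberBoundExactCountUpper
import Summits.BirchSwinnertonDyer.BirchSwinnertonDyer.Theorems.KatoDescentPotSupersingularReducibleKatoMemberNodes
import Literature.NumberTheory.EllipticCurves.Kato2004.MemberHullCountInputs
import Literature.NumberTheory.EllipticCurves.KatoRankBoundProofs
import Literature.NumberTheory.EllipticCurves.ShaIsogenyProofs
import HarnessLib

/-!
# Cell `bsd-potss`, routes K9 `KatoDescentPotSupersingular` / K8-t′ `KatoDescentTamePotSupersingular`: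
# THE UPPER HALF ON EVERY REDUCIBLE ADDITIVE POTENTIALLY GOOD ROW OF ANALYTIC RANK `0` FROM ONE
# CITE-LEVEL INPUT — `nonempty_iwasawaH1Data → exists_isNewformOf → exists_memberHullCountInputs →`
# (Cassels, GZK, modularity) `→ MissingUpperBoundAt W p`; the BODIES of the route items
# `WildUpperReducibleDefect` (stmt-BirchSwinnertonDyer-19190) and `TameUpperReducibleDefect`
# (stmt-BirchSwinnertonDyer-19203), the b2b nodes T-X3K♯ / (I-X3t)♭ and the SHARP member bound
# (T-X3K with `2t`) — ROUTE-FREE module (imports NO `Theses.*` file, so a route file / `closes` may import it)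

Seat `bsd-potss-kmc` generation 9, Part 16, consumer side.  The Literature fact
`Kato2004.exists_memberHullCountInputs` (`Kato2004/MemberHullCountInputs.lean`: the SHARP rank-`0` count
inputs at Kato's member on top of rkm's package `MemberHullInputs` — Kato (14.9.3) counted as in the proof
of Prop. 14.16 with `#H¹_f(ℤ[1/p],T)` kept as the torsion part, + the Poitou–Tate count of
`Sel(T) ⊂ S(T)` by Greenberg §3 / appendix to §4 / Cassels and Coates Lemma 3.8) gives in the KERNEL
(`MemberCountInputs.sha_add_tamagawa_le`, with the proved hull descent p437777)
`ord_p #Ш(W_K)[p^∞] + v_p Tam(W_K) ≤ ord_p(L(W_K,1)/Ω(W_K)) + 2·ord_p #W_K(ℚ)_tors` at Kato's member `W_K` —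
i.e. `ord_p #Ш(W_K) ≤ ord_p #Ш_an(W_K)` with NO torsion slack — and Cassels' isogeny invariance of the BSD
quotient (`TwistComparison.missingUpperBoundAt_of_isIsogenous`) carries it to every member `W`.  Hence:
* `missingUpperBoundAt_of_memberCountInputs`: `MissingUpperBoundAt W p` for EVERY globally minimal `W`,
  `p ≠ 2` additive potentially good, `W[p]` reducible, `r_an = 0` — no `ℤ/p²`-member / parity hypothesis;
* the BODIES of the K9 / KT items 19190 / 19203 (their defect hypotheses unused), for a planner's
  `closes` or a glued split «published inputs → U₀-red» (K8 precedent 19301; M precedent 19660/19661);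
* the b2b nodes `O6.X3PotGoodRankZeroUpperOfSmallClassTorsion` (T-X3K♯) and
  `O6.X3PotGoodRankZeroUpperOfLargeClassTorsion` ((I-X3t)♭) with their hypotheses unused;
* the SHARP member bound (`2t`) and, through `exists_memberHullInputs_of_count`, the node
  `O6.KatoMemberShaBoundOfReducible` (crux M) itself.
This supersedes, over ONE named transcription instead of three free hypothesis schemata, seat kmc part
14's `O6.x3PotGoodRankZeroUpper_of_hullReadingsSharp` (p420034-family) and the Theorems files
`…WildUpperReducibleOfHull` (p420004) / `…TameUpperReducibleOfHull` (p420005); and it makes the case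
analysis of TARGET R99 / R99′ (ℤ/p²-member void, Mazur, Ogg–Saito, odd parity at `p ≤ 7`) unnecessary
for 19190 / 19203 — granted the fact.  CONDITIONAL (audit `proof.conditional` on the three named facts
+ Cassels / GZK / modularity); no item is closed by this file.  HONEST FRAMING: BSD is not advanced; the
open mathematics of U₀-red is unchanged in content (Kato's Euler-system bound at an additive prime with
`E[p]` reducible, at the member, read EXACTLY) and is now a cite-level transcription under review flag
`Kato-14.9.3-count-Af-symbolic-member-reducible`.

References: [Kato2004Asterisque] §14.1, Cor. 14.3, §14.8, (14.9.3), Thm. 14.5, proof of Prop. 14.16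
(pp. 234–245), Thm. 12.6, 13.14, §14.14; [GreenbergLNM1716] §3, appendix to §4, Prop. 4.13;
[CoatesLNM1716] Lemma 3.8; [Wuthrich2014] Lemma 14; [Cassels1965ArithmeticVIII]; [Miller2011LMS] Def. 1.1.
-/

set_option autoImplicit false
-- sibling precedent (`KatoDescentPotSupersingularAssembly.lean`): the directory name repeats the summit name
set_option linter.dupNamespace false

noncomputable section

namespace Summit.BirchSwinnertonDyer.BirchSwinnertonDyer.Theorems.ReducibleUpperOfCountInputs

open WeierstrassCurve Literature.NumberTheory.EllipticCurves
  Literature.NumberTheory.EllipticCurves.ModularForms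
  Literature.NumberTheory.EllipticCurves.Kato2004
  Literature.NumberTheory.EllipticCurves.IwasawaAlgebra
  Literature.NumberTheory.EllipticCurves.Rank1Residual
  Literature.NumberTheory.EllipticCurves.Rank1Residual.Typed
  Summit.BirchSwinnertonDyer.Rank1Residual.Additive
  Summit.BirchSwinnertonDyer.Rank1Residual

/-- **The SHARP member bound (T-X3K with `2t`)** from Kato's published inputs at his member: granted
`nonempty_iwasawaH1Data`, `exists_isNewformOf`, `exists_memberHullCountInputs`, for `W/ℚ` globally
minimal, `p ≠ 2` additive potentially good, `W[p]` reducible, `L(W,1) ≠ 0`, `Ш(W)` finite, Kato's member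
`W' ∼ W` satisfies `ord_p #Ш(W')[p^∞] + v_p Tam(W') ≤ ord_p(L(W',1)/Ω(W')) + 2·ord_p #W'(ℚ)_tors`.
Proof: `ZetaBody` datum ⟶ cyclotomic `κ`, `γ` (PROVED existence) ⟶ `I` ⟶ the pinned lift `𝐲` ⟶ the
packages `P`, `C` ⟶ `MemberCountInputs.sha_add_tamagawa_le`.  Conditional on the three named facts.
[cite: Kato2004Asterisque, proof of Prop. 14.16 (pp. 244–245), §14.14 and Lemma 14.15 (pp. 243–244), Thm. 12.6 (p. 222)]
[cite: GreenbergLNM1716, §3 and appendix to §4] [cite: Wuthrich2014, Lemma 14 (p. 396)] -/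
theorem katoMemberShaBoundSharp_of_memberCountInputs (hne : Kato2004.nonempty_iwasawaH1Data)
    (hmod : exists_isNewformOf) (hin : Kato2004.exists_memberHullCountInputs)
    (W : WeierstrassCurve ℚ) [W.IsElliptic] [W.IsGloballyMinimal] (p : ℕ) [Fact p.Prime]
    (hp : p ≠ 2) (hng : ¬ W.HasGoodReductionAtPrime p) (hnm : ¬ W.HasMultiplicativeReductionAtPrime p)
    (hj : 0 ≤ padicValRat p W.j) (hred : ¬ W.HasIrreducibleModPGaloisRep p)
    (hL : W.entireLFunction 1 ≠ 0) (hfin : Finite W.sha) :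
    ∃ (W' : WeierstrassCurve ℚ) (_ : W'.IsElliptic) (_ : W'.IsGloballyMinimal),
      IsIsogenous W W' ∧ Finite W'.sha ∧
      ∃ q : ℚ, W'.entireLFunction 1 / (W'.realPeriodRat : ℂ) = (q : ℂ) ∧
        (padicValNat p (Nat.card (AddCommGroup.primaryComponent W'.sha p)) : ℤ) +
            padicValNat p W'.tamagawaProduct ≤
          padicValRat p q + 2 * (padicValNat p W'.torsionOrder : ℤ) := by
  -- Kato's member `W'` and the fact's data at it
  obtain ⟨W', hE', hM', hiso, hrest⟩ := hin W p hp hng hnm hj hred hL hfin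
  haveI := hE'
  haveI := hM'
  haveI : ContinuousSMul ℤ_[p] (W'.tateModule p) := TateModule.continuousSMul_padicInt
  haveI : Module.Free ℤ_[p] (W'.tateModule p) := W'.module_free_tateModule_holds p
  haveI : Module.Finite ℤ_[p] (W'.tateModule p) := W'.module_finite_tateModule_holds p
  -- a newform of `W` (modularity) and a family of complex embeddings of the cyclotomic fields
  haveI : NeZero (W.conductorNorm ℤ) := ⟨(W.conductorNorm_pos_holds).ne'⟩
  obtain ⟨f, hf⟩ := hmod W
  obtain ⟨κ', Λ', c, d, a, A, z, x, -, -, -, -, hbody, hpack⟩ :=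
    hrest f hf (fun m => Classical.arbitrary _)
  -- the cyclotomic `ℤ_p`-tower with a topological generator (PROVED), the pinned `𝐇¹_Γ(T_pW')`, the lift `𝐲`
  obtain ⟨κ, hκ, γ, hγ, -⟩ := exists_isCyclotomic_isTopGenerator_isCyclotomicVariable_holds p
  obtain ⟨I⟩ := hne W' p κ γ hκ hγ
  obtain ⟨y, hy⟩ :=
    (IwasawaH1Data.existsUnique_lift_of_zetaBody p W' hκ hp I f _ κ' Λ' c d a A z x hbody).exists
  -- the packages at `(I, 𝐲)` and the sharp member inequality
  obtain ⟨P, ⟨C⟩⟩ := hpack κ γ hκ hγ I y hy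
  have hfin' : Finite W'.sha := (IsIsogenous.shaFinite_iff_shaFinite hiso).mp hfin
  obtain ⟨q, hq, hle⟩ := C.sha_add_tamagawa_le
  exact ⟨W', hE', hM', hiso, hfin', q, hq, hle⟩

/-- **THE UPPER HALF ON EVERY REDUCIBLE ADDITIVE POTENTIALLY GOOD ROW OF ANALYTIC RANK `0`** from ONE
cite-level input: granted `nonempty_iwasawaH1Data`, `exists_isNewformOf`, `exists_memberHullCountInputs`
and the named facts Cassels (`bsdRHS_eq_of_isIsogenous`), GZK, modularity: `MissingUpperBoundAt W p` for
every globally minimal `W` with `p ≠ 2` additive potentially good, `W[p]` reducible and `r_an = 0` —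
no `ℤ/p²`-member or parity hypothesis.  Proof: the sharp member bound at `W' = W_K` is
`ord_p #Ш(W') ≤ ord_p #Ш_an(W')` (`#Ш_an = q·#tors²/Tam`, bookkeeping `exists_shaAn_eq_of_exactCount`),
transported to `W` by `TwistComparison.missingUpperBoundAt_of_isIsogenous`.  Conditional; nothing asserted.
[cite: Kato2004Asterisque, proof of Prop. 14.16 (pp. 244–245), §14.14 (p. 243)] [cite: Cassels1965ArithmeticVIII]
[cite: Miller2011LMS, Def. 1.1] -/
theorem missingUpperBoundAt_of_memberCountInputs (hne : Kato2004.nonempty_iwasawaH1Data)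
    (hmod : exists_isNewformOf) (hin : Kato2004.exists_memberHullCountInputs)
    (hCassels : bsdRHS_eq_of_isIsogenous) (hGZK : rank_eq_analyticRank_of_analyticRank_le_one)
    (hmodL : hasEntireLFunction_rat)
    (W : WeierstrassCurve ℚ) [W.IsElliptic] [W.IsGloballyMinimal] (p : ℕ) [Fact p.Prime]
    (hp : p ≠ 2) (hng : ¬ W.HasGoodReductionAtPrime p) (hnm : ¬ W.HasMultiplicativeReductionAtPrime p)
    (hj : 0 ≤ padicValRat p W.j) (hred : ¬ W.HasIrreducibleModPGaloisRep p)
    (hr : W.analyticRank = 0) : MissingUpperBoundAt W p := by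
  have hL : W.entireLFunction 1 ≠ 0 := (W.analyticRank_eq_zero_iff_holds (hmodL W)).mp hr
  have hfin : Finite W.sha := (hGZK W (by rw [hr]; exact zero_le_one)).2
  obtain ⟨W', hE', hM', hiso, hfin', q, hq, hle⟩ :=
    katoMemberShaBoundSharp_of_memberCountInputs hne hmod hin W p hp hng hnm hj hred hL hfin
  haveI := hE'
  haveI := hM'
  have hr' : W'.analyticRank = 0 := by rw [← analyticRank_eq_of_isIsogenous' hiso, hr]
  -- bookkeeping at `W'`: the slack `a ≥ 0` of the sharp inequality is the defect `ord Ш_an − ord Ш`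
  obtain ⟨q', hq', hv⟩ := exists_shaAn_eq_of_exactCount W' p hGZK hmodL hr' (b := 0)
    (a := padicValRat p q + 2 * (padicValNat p W'.torsionOrder : ℤ) -
      ((padicValNat p (Nat.card (AddCommGroup.primaryComponent W'.sha p)) : ℤ) +
        padicValNat p W'.tamagawaProduct)) hq (by ring)
  have hup' : MissingUpperBoundAt W' p := ⟨q', hq', by rw [hv]; linarith⟩
  exact TwistComparison.missingUpperBoundAt_of_isIsogenous W' W p hCassels hGZK hmodL
    hiso.symm_of_isElliptic (by rw [hr']; exact zero_le_one) hup'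

/-- **The node T-X3K (`O6.KatoMemberShaBoundOfReducible`, crux M) from the sharp fact** (forget the
counts: `exists_memberHullInputs_of_count`, then the route-free node theorem of p446895).
Conditional; nothing else assumed.
[cite: Kato2004Asterisque, Thm. 12.6 (p. 222), Prop. 14.16 (2) (p. 244)] [cite: Wuthrich2014, Lemma 14 (p. 396)] -/
theorem katoMemberShaBoundOfReducible_of_memberCountInputs (hne : Kato2004.nonempty_iwasawaH1Data)
    (hmod : exists_isNewformOf) (hin : Kato2004.exists_memberHullCountInputs) :
    O6.KatoMemberShaBoundOfReducible :=
  ReducibleKatoMemberOfInputs.katoMemberShaBoundOfReducible_of_memberHullInputs hne hmod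
    (Kato2004.exists_memberHullInputs_of_count hin)

/-- **T-X3K♯ (`O6.X3PotGoodRankZeroUpperOfSmallClassTorsion`) from the sharp fact** — its `ℤ/p²` and
parity hypotheses are not used.  Conditional; nothing asserted.
[cite: Kato2004Asterisque, proof of Prop. 14.16 (pp. 244–245)] [cite: Cassels1965ArithmeticVIII] -/
theorem x3PotGoodRankZeroUpperOfSmallClassTorsion_of_memberCountInputs
    (hne : Kato2004.nonempty_iwasawaH1Data) (hmod : exists_isNewformOf)
    (hin : Kato2004.exists_memberHullCountInputs) (hCassels : bsdRHS_eq_of_isIsogenous)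
    (hGZK : rank_eq_analyticRank_of_analyticRank_le_one) (hmodL : hasEntireLFunction_rat) :
    O6.X3PotGoodRankZeroUpperOfSmallClassTorsion := by
  intro W _ _ p _ hp hng hnm hj hred hr _ _
  exact missingUpperBoundAt_of_memberCountInputs hne hmod hin hCassels hGZK hmodL W p hp hng hnm hj
    hred hr

/-- **(I-X3t)♭ (`O6.X3PotGoodRankZeroUpperOfLargeClassTorsion`, the `ℤ/p²`-member residual conjecture of
o6-r1 GEN 21) from the sharp fact** — hypotheses unused.  Conditional; nothing asserted.
[cite: Kato2004Asterisque, proof of Prop. 14.16 (pp. 244–245)] [cite: Cassels1965ArithmeticVIII] -/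
theorem x3PotGoodRankZeroUpperOfLargeClassTorsion_of_memberCountInputs
    (hne : Kato2004.nonempty_iwasawaH1Data) (hmod : exists_isNewformOf)
    (hin : Kato2004.exists_memberHullCountInputs) (hCassels : bsdRHS_eq_of_isIsogenous)
    (hGZK : rank_eq_analyticRank_of_analyticRank_le_one) (hmodL : hasEntireLFunction_rat) :
    O6.X3PotGoodRankZeroUpperOfLargeClassTorsion := by
  intro W _ _ p _ hp hng hnm hj hred hr _ _
  exact missingUpperBoundAt_of_memberCountInputs hne hmod hin hCassels hGZK hmodL W p hp hng hnm hj
    hred hr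

/-- **BODY of the K9 item `WildUpperReducibleDefect` (stmt-BirchSwinnertonDyer-19190), route-free**
(the unfolded statement, so that a route file may derive the item inside `closes` from cite-level
inputs): on every wild (`ClassO6 W 3`) reducible row of analytic rank `0`, `MissingUpperBoundAt W 3` —
the defect hypothesis (`ℤ/9`-member or odd `ord₃ #Ш_an`) is not used.  Conditional; nothing asserted.
[cite: Kato2004Asterisque, proof of Prop. 14.16 (pp. 244–245), §14.14 (p. 243)] [cite: Cassels1965ArithmeticVIII] -/
theorem wildUpperReducibleDefect_body (hne : Kato2004.nonempty_iwasawaH1Data)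
    (hmod : exists_isNewformOf) (hin : Kato2004.exists_memberHullCountInputs)
    (hCassels : bsdRHS_eq_of_isIsogenous) (hGZK : rank_eq_analyticRank_of_analyticRank_le_one)
    (hmodL : hasEntireLFunction_rat) :
    ∀ (W : WeierstrassCurve ℚ) [W.IsElliptic] [W.IsGloballyMinimal] [Fact (3 : ℕ).Prime],
      W.analyticRank = 0 → ClassO6 W 3 → ¬ W.HasIrreducibleModPGaloisRep 3 →
      ¬ ((∀ (W' : WeierstrassCurve ℚ) [W'.IsElliptic], IsIsogenous W W' → ¬ 3 ^ 2 ∣ W'.torsionOrder) ∧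
          ∀ q : ℚ, shaAn W = (q : ℂ) → Even (padicValRat 3 q)) →
      MissingUpperBoundAt W 3 :=
  fun W _ _ _ hr hO hred _ ↦
    missingUpperBoundAt_of_memberCountInputs hne hmod hin hCassels hGZK hmodL W 3 hO.1 hO.2.1.1
      hO.2.1.2 hO.padicValRat_j_nonneg hred hr

/-- **BODY of the K8-t′ item `TameUpperReducibleDefect` (stmt-BirchSwinnertonDyer-19203), route-free**:
on every (t′) (`Addv`, `SubTprime`) reducible row of analytic rank `0` at `p ≠ 2`, `MissingUpperBoundAt W p`
— the defect hypothesis is not used (`ord_p j ≥ 0` from `ClassO5 := ⟨p ≠ 2, Addv, Or.inr SubTprime⟩`).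
Conditional; nothing asserted.
[cite: Kato2004Asterisque, proof of Prop. 14.16 (pp. 244–245), §14.14 (p. 243)] [cite: Cassels1965ArithmeticVIII] -/
theorem tameUpperReducibleDefect_body (hne : Kato2004.nonempty_iwasawaH1Data)
    (hmod : exists_isNewformOf) (hin : Kato2004.exists_memberHullCountInputs)
    (hCassels : bsdRHS_eq_of_isIsogenous) (hGZK : rank_eq_analyticRank_of_analyticRank_le_one)
    (hmodL : hasEntireLFunction_rat) :
    ∀ (W : WeierstrassCurve ℚ) [W.IsElliptic] [W.IsGloballyMinimal] (p : ℕ) [Fact p.Prime],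
      W.analyticRank = 0 → p ≠ 2 → Addv W p → SubTprime W p → ¬ W.HasIrreducibleModPGaloisRep p →
      ¬ ((∀ (W' : WeierstrassCurve ℚ) [W'.IsElliptic], IsIsogenous W W' → ¬ p ^ 2 ∣ W'.torsionOrder) ∧
          ∀ q : ℚ, shaAn W = (q : ℂ) → Even (padicValRat p q)) →
      MissingUpperBoundAt W p :=
  fun W _ _ p _ hr hp hadd hT hred _ ↦
    have hO5 : ClassO5 W p := ⟨hp, hadd, Or.inr hT⟩
    missingUpperBoundAt_of_memberCountInputs hne hmod hin hCassels hGZK hmodL W p hp hadd.1 hadd.2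
      hO5.padicValRat_j_nonneg hred hr

end Summit.BirchSwinnertonDyer.BirchSwinnertonDyer.Theorems.ReducibleUpperOfCountInputs

end
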